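import Mathlib
import Literature.Analysis.Convolution.ScaledMollifier
import HarnessLib

/-!
# Mollification on the line: derivatives of every order commute with `J_ε`, and `J_ε s → s`
# uniformly for continuous compactly supported `s`

Analysis/Convolution support file (everything proved, no definitions), the one-dimensional `deriv`
form of the mollifier toolkit `ScaledMollifier.lean` (Alinhac 2009, Thm. 7.11 Step 1; Evans 2010,
App. C.4 Thm. 7): for `f : ℝ → ℝ` of class `C^m` with compact support,
`iteratedDeriv j (J_ε f) = J_ε (iteratedDeriv j f)` for `j ≤ m` (`iteratedDeriv_mollify_eq`), and
for continuous compactly supported `s` the convergence `J_ε s → s` is UNIFORM on `ℝ`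
(`exists_mollify_sub_le`: for every `η > 0` there is `ε₀ > 0` with `|J_ε s(x) − s(x)| ≤ η` for all
`x` and all `0 < ε < ε₀`), together with the support control `J_ε f = 0` at distance `≥ 2ε` from an
interval containing the support (`mollify_eq_zero_of_Iio`, `mollify_eq_zero_of_Ioi`). Consequence
used downstream: `C^m` functions with compact support are `C^m`-limits, uniformly with all
derivatives of order `≤ m`, of smooth compactly supported functions — the density step that lowers
the regularity in the exact ladder isometry (`LadderIsometry.lean`) to the natural one
(route PhotonSphereChannels, `WindowedShellChannels`, stmt-FinalStateConjecture-14085). Folklore.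
-/

noncomputable section

namespace Literature.Analysis.Convolution

open MeasureTheory Set Function Filter Metric Topology

/-! ### Derivatives commute with mollification -/

/-- `(J_ε f)' = J_ε (f')` for `f ∈ C¹` with compact support. [cite: Evans2010, App. C.4 Thm. 7] -/
theorem deriv_mollify_eq (ε : ℝ) {f : ℝ → ℝ} (hf : ContDiff ℝ 1 f) (hfc : HasCompactSupport f)
    (x : ℝ) : deriv (mollify ε f) x = mollify ε (deriv f) x := by
  have h := fderiv_mollify_apply_eq_mollify ε hf hfc x 1
  have e : (fun y => fderiv ℝ f y 1) = deriv f := by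
    funext y; rfl
  rw [e] at h
  exact h

/-- Iterated derivatives of a `C^m` function with compact support have compact support. [folklore] -/
theorem hasCompactSupport_iteratedDeriv {f : ℝ → ℝ} (hfc : HasCompactSupport f) (j : ℕ) :
    HasCompactSupport (iteratedDeriv j f) := by
  induction j with
  | zero => simpa using hfc
  | succ j ih => rw [iteratedDeriv_succ]; exact ih.deriv

/-- **`iteratedDeriv j (J_ε f) = J_ε (iteratedDeriv j f)`** for `j ≤ m`, `f ∈ C^m` with compact
support. [cite: Evans2010, App. C.4 Thm. 7] -/
theorem iteratedDeriv_mollify_eq (ε : ℝ) {m : ℕ} {f : ℝ → ℝ} (hf : ContDiff ℝ m f)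
    (hfc : HasCompactSupport f) : ∀ j, j ≤ m →
      iteratedDeriv j (mollify ε f) = mollify ε (iteratedDeriv j f) := by
  intro j
  induction j with
  | zero => intro _; simp
  | succ j ih =>
    intro hj
    have ih' := ih (by omega)
    rw [iteratedDeriv_succ, ih', iteratedDeriv_succ]
    -- `iteratedDeriv j f ∈ C¹` with compact support
    have hC1 : ContDiff ℝ 1 (iteratedDeriv j f) := by
      rw [iteratedDeriv_eq_iterate]
      have : ContDiff ℝ ((1 : ℕ∞) + (j : ℕ∞)) f := by
        have h' : ContDiff ℝ ((1 + j : ℕ) : ℕ∞) f := hf.of_le (by exact_mod_cast (by omega : 1 + j ≤ m))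
        exact_mod_cast h'
      exact_mod_cast ContDiff.iterate_deriv' 1 j this
    funext x
    exact deriv_mollify_eq ε hC1 (hasCompactSupport_iteratedDeriv hfc j) x

/-! ### Uniform convergence and support -/

/-- **Uniform convergence `J_ε s → s`** for continuous compactly supported `s`.
[cite: AlinhacHPDE2009, Thm. 7.11 proof Step 1] -/
theorem exists_mollify_sub_le {s : ℝ → ℝ} (hs : Continuous s) (hsc : HasCompactSupport s)
    {η : ℝ} (hη : 0 < η) :
    ∃ ε₀ : ℝ, 0 < ε₀ ∧ ∀ ε, 0 < ε → ε < ε₀ → ∀ x, |mollify ε s x - s x| ≤ η := by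
  have huc : UniformContinuous s := hsc.uniformContinuous_of_continuous hs
  obtain ⟨δ, hδ, hδs⟩ := Metric.uniformContinuous_iff.1 huc η hη
  refine ⟨δ / 2, by positivity, fun ε hε hεδ x => ?_⟩
  have h := dist_mollify_le (E := ℝ) (F := ℝ) hε hs.aestronglyMeasurable (x := x) (δ := η)
    (fun y hy => by
      have hyx : dist y x < δ := by
        rw [mem_ball] at hy; linarith
      exact (hδs hyx).le)
  rwa [Real.dist_eq] at h

/-- If `f = 0` on `(−∞, b)` then `J_ε f = 0` on `(−∞, b − 2ε)`. [folklore] -/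
theorem mollify_eq_zero_of_Iio {ε : ℝ} (hε : 0 < ε) {f : ℝ → ℝ} {b : ℝ}
    (h : ∀ y, y < b → f y = 0) {x : ℝ} (hx : x ≤ b - 2 * ε) : mollify ε f x = 0 := by
  refine mollify_eq_zero_of_ball (E := ℝ) (F := ℝ) hε fun y hy => h y ?_
  rw [mem_ball, Real.dist_eq] at hy
  have := (abs_lt.1 hy).2
  linarith

/-- If `f = 0` on `(a, ∞)` then `J_ε f = 0` on `(a + 2ε, ∞)`. [folklore] -/
theorem mollify_eq_zero_of_Ioi {ε : ℝ} (hε : 0 < ε) {f : ℝ → ℝ} {a : ℝ}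
    (h : ∀ y, a < y → f y = 0) {x : ℝ} (hx : a + 2 * ε ≤ x) : mollify ε f x = 0 := by
  refine mollify_eq_zero_of_ball (E := ℝ) (F := ℝ) hε fun y hy => h y ?_
  rw [mem_ball, Real.dist_eq] at hy
  have := (abs_lt.1 hy).1
  linarith

/-- `J_ε f` is smooth for continuous `f`. [cite: AlinhacHPDE2009, Thm. 7.11 proof Step 1] -/
theorem contDiff_mollify_of_continuous (ε : ℝ) {f : ℝ → ℝ} (hf : Continuous f) {n : ℕ∞} :
    ContDiff ℝ n (mollify ε f) :=
  contDiff_mollify (E := ℝ) (F := ℝ) ε hf.locallyIntegrable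

/-- **Smooth approximation in `C^m` with support control.** For `f ∈ C^m` vanishing on `(−∞, a)`
and on `(b, ∞)` and every `η > 0`, `ε₁ > 0` there are `ε ∈ (0, ε₁)` and a smooth `φ` vanishing on
`(−∞, a − 2ε]` and on `[b + 2ε, ∞)` with `|φ⁽ʲ⁾(x) − f⁽ʲ⁾(x)| ≤ η` for all `x` and all `j ≤ m`.
[cite: Evans2010, App. C.4 Thm. 7] -/
theorem exists_smooth_approx_Ck {m : ℕ} {f : ℝ → ℝ} (hf : ContDiff ℝ m f) {a b : ℝ}
    (ha : ∀ y, y < a → f y = 0) (hb : ∀ y, b < y → f y = 0) {η ε₁ : ℝ} (hη : 0 < η) (hε₁ : 0 < ε₁) :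
    ∃ ε : ℝ, 0 < ε ∧ ε < ε₁ ∧ ∃ φ : ℝ → ℝ, ContDiff ℝ (⊤ : ℕ∞) φ ∧
      (∀ x, x ≤ a - 2 * ε → φ x = 0) ∧ (∀ x, b + 2 * ε ≤ x → φ x = 0) ∧
      ∀ j, j ≤ m → ∀ x, |iteratedDeriv j φ x - iteratedDeriv j f x| ≤ η := by
  -- compact support
  have hfc : HasCompactSupport f := by
    refine HasCompactSupport.intro (isCompact_Icc (a := a) (b := b)) fun x hx => ?_
    rcases lt_or_ge x a with h1 | h1
    · exact ha x h1
    · have : b < x := by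
        by_contra h2
        exact hx ⟨h1, not_lt.1 h2⟩
      exact hb x this
  -- a common `ε₀` for all orders `j ≤ m`
  have key : ∀ j, j ≤ m → ∃ ε₀ : ℝ, 0 < ε₀ ∧ ∀ ε, 0 < ε → ε < ε₀ → ∀ x,
      |mollify ε (iteratedDeriv j f) x - iteratedDeriv j f x| ≤ η := fun j hj =>
    exists_mollify_sub_le (hf.continuous_iteratedDeriv j (by exact_mod_cast hj))
      (hasCompactSupport_iteratedDeriv hfc j) hη
  choose! e he using key
  set ε₀ : ℝ := (Finset.range (m + 1)).inf' ⟨0, by simp⟩ e with hε₀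
  have hε₀pos : 0 < ε₀ := by
    rw [hε₀, Finset.lt_inf'_iff]
    intro j hj
    exact (he j (Nat.lt_succ_iff.1 (Finset.mem_range.1 hj))).1
  have hε₀le : ∀ j, j ≤ m → ε₀ ≤ e j := fun j hj =>
    Finset.inf'_le _ (Finset.mem_range.2 (Nat.lt_succ_of_le hj))
  set ε : ℝ := min ε₀ ε₁ / 2 with hεdef
  have hεpos : 0 < ε := by rw [hεdef]; positivity
  have hε1 : ε < ε₁ := by
    rw [hεdef]; have := min_le_right ε₀ ε₁; linarith
  have hε0 : ε < ε₀ := by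
    rw [hεdef]; have := min_le_left ε₀ ε₁; linarith
  refine ⟨ε, hεpos, hε1, mollify ε f, contDiff_mollify_of_continuous ε hf.continuous, ?_, ?_, ?_⟩
  · intro x hx
    exact mollify_eq_zero_of_Iio hεpos ha hx
  · intro x hx
    exact mollify_eq_zero_of_Ioi hεpos hb hx
  · intro j hj x
    rw [congrFun (iteratedDeriv_mollify_eq ε hf hfc j hj) x]
    exact (he j hj).2 ε hεpos (lt_of_lt_of_le hε0 (hε₀le j hj)) x

end Literature.Analysis.Convolution
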